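import Mathlib
import HarnessLib
import Summits.Ventures.LatticeQCDFlow.Exactness.SUNLeapfrogHMCEngine

/-!
# The engine's kinetic term in coordinates IS `−tr P²`: `tr (ι c)² = −(Σ_i d_i² + 2 Σ_{i<j} (R_ij² + I_ij²))`

HONEST FRAMING: exact (Metropolis-corrected) sampling algorithms for lattice gauge theory;
figures of merit are autocorrelation/cost numbers at stated couplings and volumes; no
continuum-physics claim.

Venture `LatticeQCDFlow` (cell pub-lqcd), topic `Exactness`, FANOUT row 9 (eng-latcore, the
engine `latflow.core.hmc.HMC.kinetic` / `sun_2d.HMC2D.kinetic`: `−Σ_l Re tr(P_l P_l)`).  NEW WORK of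
the cell over the tree (`SUNKickCoordinates.lean`: the coordinates `sunCoordι`;
`SUNLeapfrogHMCEngine.lean`: the quadratic form `sunCoordQuad`, the kinetic term `sunKinetic`);
nothing is cited as a fact.  The dictionary lemma `SUNLeapfrogHMCEngine.lean` left as NOT CLAIMED:

* `sum_sq_eq_diag_add_two_upper` — for a symmetric family `f i k = f k i` on `Fin N × Fin N`:
  `Σ_i Σ_k f i k = Σ_i f i i + 2 Σ_{i<k} f i k` (sum over the subtype `UpperPair N`);
* **`trace_sunCoordι_sq`** — `tr ((ι c) (ι c)) = −q(c)` (a real number), `q = sunCoordQuad`;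
  **`sunKinetic_eq_neg_trace`** — `sunKinetic N p = −Σ_l Re tr ((ι (p l))²)`: the kinetic term of
  `SUNLeapfrogHMCEngine.lean` is literally the engine's `kinetic`.

NOT CLAIMED: anything else.
-/

noncomputable section

namespace Summit.Ventures.LatticeQCDFlow.Exactness

open Finset
open scoped Matrix ComplexConjugate

variable (N : ℕ)

/-- **Splitting a symmetric double sum**: `Σ_i Σ_k f i k = Σ_i f i i + 2 Σ_{i<k} f i k`. -/
theorem sum_sq_eq_diag_add_two_upper {α : Type*} [AddCommMonoid α] (f : Fin N → Fin N → α)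
    (hf : ∀ i k, f i k = f k i) :
    ∑ i, ∑ k, f i k = ∑ i, f i i + 2 • ∑ p : UpperPair N, f p.1.1 p.1.2 := by
  classical
  -- write the double sum as a sum over pairs and split into `i = k`, `i < k`, `k < i`
  have hpair : ∑ i, ∑ k, f i k = ∑ p ∈ (univ : Finset (Fin N × Fin N)), f p.1 p.2 := by
    rw [← Finset.sum_product']
    rfl
  have hsplit : ∑ p ∈ (univ : Finset (Fin N × Fin N)), f p.1 p.2 =
      ∑ p ∈ univ.filter (fun p : Fin N × Fin N => p.1 = p.2), f p.1 p.2 +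
      (∑ p ∈ univ.filter (fun p : Fin N × Fin N => p.1 < p.2), f p.1 p.2 +
       ∑ p ∈ univ.filter (fun p : Fin N × Fin N => p.2 < p.1), f p.1 p.2) := by
    rw [← Finset.sum_filter_add_sum_filter_not univ (fun p : Fin N × Fin N => p.1 = p.2)]
    congr 1
    rw [← Finset.sum_filter_add_sum_filter_not (univ.filter fun p : Fin N × Fin N => ¬p.1 = p.2)
      (fun p : Fin N × Fin N => p.1 < p.2), Finset.filter_filter, Finset.filter_filter]
    congr 1
    · refine Finset.sum_congr ?_ fun _ _ => rfl
      ext p; simp only [mem_filter, mem_univ, true_and]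
      exact ⟨fun h => h.2, fun h => ⟨h.ne, h⟩⟩
    · refine Finset.sum_congr ?_ fun _ _ => rfl
      ext p; simp only [mem_filter, mem_univ, true_and, not_lt]
      constructor
      · rintro ⟨hne, hle⟩; exact lt_of_le_of_ne hle (Ne.symm hne)
      · intro h; exact ⟨h.ne', h.le⟩
  -- the diagonal
  have hdiag : ∑ p ∈ univ.filter (fun p : Fin N × Fin N => p.1 = p.2), f p.1 p.2 = ∑ i, f i i := by
    rw [Finset.sum_filter, ← Finset.univ_product_univ, Finset.sum_product]
    refine Finset.sum_congr rfl fun i _ => ?_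
    rw [Finset.sum_ite_eq univ i (f i)]
    simp
  -- the lower triangle equals the upper one (swap)
  have hlow : ∑ p ∈ univ.filter (fun p : Fin N × Fin N => p.2 < p.1), f p.1 p.2 =
      ∑ p ∈ univ.filter (fun p : Fin N × Fin N => p.1 < p.2), f p.1 p.2 := by
    refine Finset.sum_bij (fun p _ => (p.2, p.1)) (fun p hp => ?_) (fun p hp q hq h => ?_) (fun q hq => ?_) (fun p hp => ?_)
    · simp only [mem_filter, mem_univ, true_and] at hp ⊢; exact hp
    · exact Prod.ext (congrArg Prod.snd h) (congrArg Prod.fst h)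
    · refine ⟨(q.2, q.1), ?_, rfl⟩
      simp only [mem_filter, mem_univ, true_and] at hq ⊢; exact hq
    · exact hf _ _
  -- the upper triangle as a sum over the subtype
  have hup : ∑ p ∈ univ.filter (fun p : Fin N × Fin N => p.1 < p.2), f p.1 p.2 = ∑ p : UpperPair N, f p.1.1 p.1.2 :=
    Finset.sum_subtype (univ.filter fun p : Fin N × Fin N => p.1 < p.2) (fun p => by simp)
      (fun p : Fin N × Fin N => f p.1 p.2)
  rw [hpair, hsplit, hdiag, hlow, hup, two_nsmul]

/-- **`tr ((ι c)(ι c)) = −q(c)`**: the trace of the square of the engine's matrix of a coordinate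
vector is minus the quadratic form `Σ_i d_i² + 2 Σ_{i<j} (R_ij² + I_ij²)`. -/
theorem trace_sunCoordι_sq (c : SUNCoords N) :
    (sunCoordι N c * sunCoordι N c).trace = -((sunCoordQuad N c : ℝ) : ℂ) := by
  have htr : (sunCoordι N c * sunCoordι N c).trace = ∑ i, ∑ k, sunCoordι N c i k * sunCoordι N c k i := by
    simp only [Matrix.trace, Matrix.diag_apply, Matrix.mul_apply]
  rw [htr, sum_sq_eq_diag_add_two_upper N (fun i k => sunCoordι N c i k * sunCoordι N c k i)
    (fun i k => mul_comm _ _)]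
  have hdiag : ∀ i, sunCoordι N c i i * sunCoordι N c i i = -((((c.1 : Fin N → ℝ) i) ^ 2 : ℝ) : ℂ) := fun i => by
    rw [sunCoordι_apply, sunCoordMatrix_apply_self]
    push_cast
    linear_combination (((c.1 : Fin N → ℝ) i : ℂ)) ^ 2 * Complex.I_sq
  have hoff : ∀ p : UpperPair N, sunCoordι N c p.1.1 p.1.2 * sunCoordι N c p.1.2 p.1.1 =
      -((((c.2.1 p) ^ 2 + (c.2.2 p) ^ 2 : ℝ)) : ℂ) := fun p => by
    rw [sunCoordι_apply, sunCoordMatrix_apply_of_lt N _ _ _ p.2, sunCoordMatrix_apply_of_gt N _ _ _ p.2]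
    push_cast
    linear_combination ((c.2.2 p : ℂ)) ^ 2 * Complex.I_sq
  simp_rw [hdiag, hoff]
  rw [sunCoordQuad]
  push_cast
  rw [Finset.sum_neg_distrib, Finset.sum_neg_distrib]
  ring

/-- **The kinetic term of `SUNLeapfrogHMCEngine.lean` IS the engine's `kinetic = −Σ_l Re tr(P_l P_l)`.** -/
theorem sunKinetic_eq_neg_trace {L : Type*} [Fintype L] (p : L → SUNCoords N) :
    sunKinetic N p = -∑ l, ((sunCoordι N (p l) * sunCoordι N (p l)).trace).re := by
  simp_rw [trace_sunCoordι_sq, Complex.neg_re, Complex.ofReal_re]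
  rw [sunKinetic, Finset.sum_neg_distrib, neg_neg]

end Summit.Ventures.LatticeQCDFlow.Exactness
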